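import Summits.AnomalousDissipation.AnomalousDissipation.Theses.BaireTransfer

/-!
# AnomalousDissipation / BaireTransfer — support item `DensityGlue`

Route `AnomalousDissipation/BaireTransfer`, item stmt-AnomalousDissipation-1147 (`DensityGlue`,
support, rank 9): the GLUE of the two ranked cruxes into the Baire target,
`DenseLoudDesignerForces → RobustLoudUpgrade → BaireTarget`.

Proof (pure point-set topology, as in the planner's sketch): take the stock `S₀` from
`RobustLoudUpgrade`; `DenseLoudDesignerForces S₀` gives `S ⊇ S₀`, budgets `E`, `ε > 0` and a
non-empty open `U` with `U ⊆ closure LOUD_j(S,E,ε)` for every level `j`; the witnesses for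
`BaireTarget` are `(S, 2E, ε/2, U)`: for each `j`,
`U ⊆ closure LOUD_j(S,E,ε) ⊆ closure (interior LOUD_j(S,2E,ε/2))`, the second inclusion being
`closure_minimal` applied to `RobustLoudUpgrade` (`LOUD_j(S,E,ε) ⊆ closure (interior LOUD_j(S,2E,ε/2))`)
and the closedness of a closure; `0 < ε/2` by `positivity`.

Nothing about Navier–Stokes is used: the loud sets enter only through the two hypotheses.
-/

-- `Summit.<Summit>.<Problem>` is the tree's mandated summit-side namespace (CONVENTIONS §2); for this
-- single-conjunct summit the two coincide, so the duplicate is deliberate.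
set_option linter.dupNamespace false

namespace Summit.AnomalousDissipation.AnomalousDissipation.Theorems

open Summit.AnomalousDissipation.AnomalousDissipation.Theses.BaireTransfer

/-- Settles stmt-AnomalousDissipation-1147 (support item `DensityGlue` of route BaireTransfer):
`DenseLoudDesignerForces → RobustLoudUpgrade → BaireTarget`.  With `S₀` from `RobustLoudUpgrade`
and `(S ⊇ S₀, E, ε, U)` from `DenseLoudDesignerForces S₀`, the target holds with witnesses
`(S, 2E, ε/2, U)`: `U ⊆ closure LOUD_j(E,ε) ⊆ closure (interior LOUD_j(2E,ε/2))` by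
`closure_minimal` and `isClosed_closure`. [folklore] -/
theorem densityGlue_proof : DensityGlue := by
  unfold DensityGlue
  intro hD hR
  obtain ⟨S₀, hS₀⟩ := hR
  obtain ⟨S, hSS, E, ε, hε, U, hUo, hUne, hUd⟩ := hD S₀
  refine ⟨S, 2 * E, ε / 2, by positivity, U, hUo, hUne, fun j => ?_⟩
  exact (hUd j).trans (closure_minimal (hS₀ S hSS E ε hε j) isClosed_closure)

end Summit.AnomalousDissipation.AnomalousDissipation.Theorems
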